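import Literature.Geometry.Riemannian.ThreeShrinkerDegenerateDevelopingMap
import Literature.Geometry.Riemannian.ThreeShrinkerDegenerateNull
import HarnessLib

/-!
# Degenerate three-dimensional shrinkers: gluing two developing maps into a local isometry
# `C = S²(√2) × ℝ → M` defined on the whole model

Continuation of `ThreeShrinkerDegenerateDevelopingMap` (degenerate case of Munteanu–Wang 2016,
Thm. 1.2). Cartan's developing map `F₁ = devMap` built at `õ ∈ S²` is smooth and isometric off the
antipodal ray `{ŷ = −õ}` of the conformal cylinder `C = (ℝ³ ∖ 0, 2|y|⁻²δ)`. As in do Carmo's proof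
of the space-form theorem (Ch. 8, Thm. 4.1) we build a second developing map `F₂` at `õ' ⊥ õ` out of
the 1-jet of `F₁` at `õ'` — its frame is `(dF₁(e₀')/√2, dF₁(e₁')/√2, dF₁(õ')/√2)`, the last vector
being `Ric`-null because **the developing map sends the radial direction to the null line**
(`ThreeShrinkerDegenerateNull`) — show that the 1-jets of `F₁`, `F₂` agree at `õ'`
(`mfderiv_devMap_basePt_apply`: `dF_{õ} ζ = √2(⟨ζ,e₀⟩a₁ + ⟨ζ,e₁⟩a₂ + ⟨ζ,õ⟩ν)`), conclude
`F₁ = F₂` on the preconnected overlap by the rigidity of local isometries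
(`IsometryRigidity.eqOn_of_isometry_of_oneJet_eq`), and glue. Main result:

* **`exists_isometric_developing`** — for a complete connected normalised degenerate shrinker with
  `S ≡ 1` and a critical point `p` of `f` with `f(p) = 1` there is a `C^∞` map `Φ : C → M` with
  `g(dΦ u, dΦ w) = g_c(u, w)` everywhere, `f ∘ Φ = f_C` (`= (log|y|)²/2 + 1`), `Φ(õ) = p`, and
  `dΦ_y(y)` `Ric`-null for every `y`.

Everything is proved; the only new `def`s are the explicit second-chart data (no named facts,
D-0026).

## References

* O. Munteanu, J. Wang, arXiv:1606.01861, Thm. 1.2 (p. 3). [MunteanuWang2016]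
* M. P. do Carmo, *Riemannian Geometry*, Birkhäuser 1992, Ch. 8, Thm. 4.1 (proof). [doCarmo1992]
* B. O'Neill, *Semi-Riemannian Geometry*, Academic Press 1983, Ch. 3, Prop. 3.62. [ONeill1983]
-/

noncomputable section

open Bundle Set Function Filter Module Metric
open scoped Manifold ContDiff Topology NNReal RealInnerProductSpace

namespace Literature.Geometry.Riemannian

open Lorentzian Lorentzian.PseudoRiemannianMetric RoundCylinderThree

/-- Shorthand: the round metric of `S² ⊂ ℝ³`. -/
local notation "gS" => roundMetric (n := 2) (EuclideanSpace ℝ (Fin 3))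

/-- Shorthand: the model plane of `S²`. -/
local notation "E2" => EuclideanSpace ℝ (Fin 2)

/-- `dι[o]`: the differential of the inclusion `S² ↪ ℝ³` at `o`, as a map into `ℝ³`. -/
local notation "dι[" o "]" => mfderiv (𝓡 2) 𝓘(ℝ, E3) (Subtype.val : sphere (0 : E3) 1 → E3) o

/-- The Euclidean inner product of `ℝ³` (forcing the carrier `E3` on tangent-space-typed terms). -/
local notation "⟪" x ", " y "⟫ₑ" => @inner ℝ E3 _ x y

attribute [local instance] contMDiffCovariantDerivative_roundMetric_one
  contMDiffCovariantDerivative_roundMetric_top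

/-! ### Elementary facts in `ℝ³` and on `S²` -/

section Model

/-- Expansion in an orthonormal triple of `ℝ³`. [folklore] -/
theorem eq_sum_inner_of_orthonormal_three {b₀ b₁ b₂ : E3} (h00 : ⟪b₀, b₀⟫ = 1) (h11 : ⟪b₁, b₁⟫ = 1)
    (h22 : ⟪b₂, b₂⟫ = 1) (h01 : ⟪b₀, b₁⟫ = 0) (h02 : ⟪b₀, b₂⟫ = 0) (h12 : ⟪b₁, b₂⟫ = 0) (ζ : E3) :
    ζ = ⟪ζ, b₀⟫ • b₀ + ⟪ζ, b₁⟫ • b₁ + ⟪ζ, b₂⟫ • b₂ := by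
  have hn : ∀ {b : E3}, ⟪b, b⟫ = 1 → ‖b‖ = 1 := fun {b} h ↦ by
    have h2 : ‖b‖ ^ 2 = 1 := by rw [← real_inner_self_eq_norm_sq]; exact h
    nlinarith [norm_nonneg b, h2]
  have hon : Orthonormal ℝ ![b₀, b₁, b₂] := by
    rw [orthonormal_iff_ite]
    intro i j
    have h10 : ⟪b₁, b₀⟫ = 0 := by rw [real_inner_comm]; exact h01
    have h20 : ⟪b₂, b₀⟫ = 0 := by rw [real_inner_comm]; exact h02
    have h21 : ⟪b₂, b₁⟫ = 0 := by rw [real_inner_comm]; exact h12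
    fin_cases i <;> fin_cases j <;> simp [hn h00, hn h11, hn h22, h01, h02, h12, h10, h20, h21]
  have hcard : Fintype.card (Fin 3) = finrank ℝ E3 := by
    change Fintype.card (Fin 3) = finrank ℝ (EuclideanSpace ℝ (Fin 3)); simp
  set b := basisOfOrthonormalOfCardEqFinrank hon hcard with hb_def
  have hb : ⇑b = ![b₀, b₁, b₂] := coe_basisOfOrthonormalOfCardEqFinrank hon hcard
  have hsum := b.sum_repr ζ
  rw [Fin.sum_univ_three, hb] at hsum
  have e0 : (![b₀, b₁, b₂] : Fin 3 → E3) 0 = b₀ := rfl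
  have e1 : (![b₀, b₁, b₂] : Fin 3 → E3) 1 = b₁ := rfl
  have e2 : (![b₀, b₁, b₂] : Fin 3 → E3) 2 = b₂ := rfl
  rw [e0, e1, e2] at hsum
  have h10 : ⟪b₁, b₀⟫ = 0 := by rw [real_inner_comm]; exact h01
  have h20 : ⟪b₂, b₀⟫ = 0 := by rw [real_inner_comm]; exact h02
  have h21 : ⟪b₂, b₁⟫ = 0 := by rw [real_inner_comm]; exact h12
  have c0 := congrArg (fun v ↦ ⟪v, b₀⟫) hsum
  have c1 := congrArg (fun v ↦ ⟪v, b₁⟫) hsum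
  have c2 := congrArg (fun v ↦ ⟪v, b₂⟫) hsum
  simp only [inner_add_left, real_inner_smul_left, h00, h11, h22, h01, h02, h12, h10, h20, h21,
    mul_one, mul_zero, add_zero, zero_add] at c0 c1 c2
  rw [← c0, ← c1, ← c2]
  exact hsum.symm

/-- `nE (c • q) = q` for `c > 0` and `|q| = 1`. [folklore] -/
theorem nE_smul_of_pos {c : ℝ} (hc : 0 < c) {q : E3} (hq : ‖q‖ = 1) : nE (c • q) = q := by
  rw [nE, norm_smul, Real.norm_eq_abs, abs_of_pos hc, hq, mul_one, smul_smul, inv_mul_cancel₀ hc.ne',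
    one_smul]

/-- A point of the sphere, negated, is a point of the sphere. [folklore] -/
def negPt (o : sphere (0 : E3) 1) : sphere (0 : E3) 1 := ⟨-(o : E3), by simp⟩

/-- `(negPt o : ℝ³) = −o`. [folklore] -/
@[simp] theorem coe_negPt (o : sphere (0 : E3) 1) : ((negPt o : sphere (0 : E3) 1) : E3) = -(o : E3) :=
  rfl

/-- `y ∈ Uo o ↔ hat y ≠ negPt o`. [folklore] -/
theorem mem_Uo_iff (o : sphere (0 : E3) 1) (y : P3) : y ∈ Uo o ↔ hat y ≠ negPt o := by
  change (hat y : E3) ≠ -(o : E3) ↔ _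
  rw [Ne, Ne, ← coe_negPt, Subtype.ext_iff]

/-- **The overlap `Uo o ∩ Uo o'` is preconnected** (it is the image of
`(S² ∖ {−o, −o'}) × ℝ` under `(q, t) ↦ eᵗ q`). [folklore] -/
theorem isPreconnected_Uo_inter (o o' : sphere (0 : E3) 1) : IsPreconnected (Uo o ∩ Uo o') := by
  set ψ : sphere (0 : E3) 1 × ℝ → P3 := fun qt ↦ ⟨Real.exp qt.2 • (qt.1 : E3), by
    intro h
    have h' : Real.exp qt.2 • (qt.1 : E3) = 0 := h
    rcases smul_eq_zero.1 h' with h1 | h1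
    · exact (Real.exp_pos _).ne' h1
    · have := norm_eq_of_mem_sphere qt.1
      rw [h1, norm_zero] at this
      exact zero_ne_one this⟩ with hψ
  have hcont : Continuous ψ := by
    refine Continuous.subtype_mk ?_ _
    exact (Real.continuous_exp.comp continuous_snd).smul (continuous_subtype_val.comp continuous_fst)
  have hS : IsPreconnected ({q : sphere (0 : E3) 1 | q ≠ negPt o ∧ q ≠ negPt o'} ×ˢ (univ : Set ℝ)) :=
    (SphereLocalIsometry.isPreconnected_ne_ne (n := 2) le_rfl (negPt o) (negPt o')).prod
      isPreconnected_univ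
  have himage : ψ '' ({q : sphere (0 : E3) 1 | q ≠ negPt o ∧ q ≠ negPt o'} ×ˢ (univ : Set ℝ)) =
      Uo o ∩ Uo o' := by
    ext y
    constructor
    · rintro ⟨⟨q, t⟩, ⟨⟨hq1, hq2⟩, -⟩, rfl⟩
      have hhat : hat (ψ (q, t)) = q := by
        apply Subtype.ext
        rw [coe_hat]
        exact nE_smul_of_pos (Real.exp_pos t) (norm_eq_of_mem_sphere q)
      rw [mem_inter_iff, mem_Uo_iff, mem_Uo_iff, hhat]
      exact ⟨hq1, hq2⟩
    · rintro ⟨hy1, hy2⟩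
      refine ⟨(hat y, Real.log ‖(y : E3)‖), ⟨⟨(mem_Uo_iff o y).1 hy1, (mem_Uo_iff o' y).1 hy2⟩,
        mem_univ _⟩, ?_⟩
      apply Subtype.ext
      change Real.exp (Real.log ‖(y : E3)‖) • (hat y : E3) = y
      rw [Real.exp_log (norm_pos y), coe_hat, nE, smul_smul, mul_inv_cancel₀ (norm_pos y).ne', one_smul]
  rw [← himage]
  exact hS.image ψ hcont.continuousOn

/-- Orthogonal points of the sphere are not antipodal, read in `Uo`. [folklore] -/
theorem basePt_mem_Uo_of_inner_eq_zero {o o' : sphere (0 : E3) 1} (h : ⟪(o' : E3), (o : E3)⟫ = 0) :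
    basePt o' ∈ Uo o := by
  change (hat (basePt o') : E3) ≠ -(o : E3)
  rw [hat_basePt]
  exact (SphereLocalIsometry.ne_neg_of_inner_eq_zero (n := 2) h).1

/-- `d(exp_õ)_0 = id`, with the zero of the model plane. [folklore] -/
theorem sphere_mfderiv_zero_apply' (o : sphere (0 : E3) 1) (lam : E2) :
    mfderiv 𝓘(ℝ, E2) (𝓡 2) (SphereLocalIsometry.sphereExp E3 2 o) (0 : E2) lam = lam :=
  sphere_mfderiv_zero_apply o lam

/-- Tangent vectors of the sphere are orthogonal to the position (`mfderiv` form, Euclidean inner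
product of `ℝ³`). [folklore] -/
theorem inner_coe_mfderiv_coe_sphere (o : sphere (0 : E3) 1) (v : TangentSpace (𝓡 2) o) :
    ⟪(o : E3), dι[o] v⟫ₑ = 0 :=
  inner_coe_mvfderiv_coe_sphere o v

/-- `g_round(v, w) = ⟨dι v, dι w⟩` with the Euclidean inner product of `ℝ³`. [folklore] -/
theorem roundMetric_apply_E3 (o : sphere (0 : E3) 1) (v w : TangentSpace (𝓡 2) o) :
    (gS).val o v w = ⟪dι[o] v, dι[o] w⟫ₑ :=
  roundMetric_apply o v w

/-- **The differential of `Lg o` at the base point, read in `ℝ³`**: `dι_õ(d(LgE o)_õ ζ) = ζ − ⟨õ,ζ⟩ õ`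
(the tangential projection). [folklore] -/
theorem mfderiv_coe_fderiv_LgE_basePt (o : sphere (0 : E3) 1) (ζ : E3) :
    (dι[o] (fderiv ℝ (LgE o) (basePt o : E3) ζ) : E3) = ζ + (-⟪(o : E3), ζ⟫) • (o : E3) := by
  have hy := basePt_mem_Uo o
  -- the identity `dι(d exp_l (dLgE ζ)) = d(y/|y|) ζ` at `y = õ`, `l = Lg õ = 0`
  have h1 : MDifferentiableAt (𝓡 2) 𝓘(ℝ, E3) ((↑) : sphere (0 : E3) 1 → E3)
      (SphereLocalIsometry.sphereExp E3 2 o (Lg o (basePt o))) :=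
    (contMDiff_coe_sphere (m := ∞) _).mdifferentiableAt (by simp)
  have h2 : MDifferentiableAt 𝓘(ℝ, E2) (𝓡 2) (SphereLocalIsometry.sphereExp E3 2 o) (Lg o (basePt o)) :=
    (SphereLocalIsometry.contMDiff_sphereExp o _).mdifferentiableAt (by simp)
  have h3 : MDifferentiableAt 𝓘(ℝ, E3) 𝓘(ℝ, E2) (Lg o) (basePt o) :=
    (contMDiffAt_Lg hy).mdifferentiableAt (by simp)
  set Φ : P3 → E3 := fun y' ↦ ((SphereLocalIsometry.sphereExp E3 2 o (Lg o y') :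
    sphere (0 : E3) 1) : E3) with hΦ
  have hev : Φ =ᶠ[𝓝 (basePt o)] fun y' : P3 ↦ nE (y' : E3) := by
    filter_upwards [(isOpen_Uo o).mem_nhds hy] with y' hy'
    simp only [hΦ, sphereExp_Lg hy', coe_hat]
  have hdΦ : mfderiv 𝓘(ℝ, E3) 𝓘(ℝ, E3) Φ (basePt o) = fderiv ℝ nE (basePt o : E3) := by
    rw [hev.mfderiv_eq]
    exact OpensChart.mfderiv_eq (basePt o) (fun y' : P3 ↦ nE (y' : E3)) nE (fun _ ↦ rfl)
      ((contDiffAt_nE (n := 1) (coe_ne_zero _)).differentiableAt one_ne_zero)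
  have h23 := mfderiv_comp (basePt o) h2 h3
  have h123 := mfderiv_comp (basePt o) h1 (h2.comp (basePt o) h3)
  have hΦ' : Φ = ((↑) : sphere (0 : E3) 1 → E3) ∘ (SphereLocalIsometry.sphereExp E3 2 o ∘ Lg o) :=
    rfl
  rw [← hΦ'] at h123
  have hvec : (dι[SphereLocalIsometry.sphereExp E3 2 o (Lg o (basePt o))]
      (mfderiv 𝓘(ℝ, E2) (𝓡 2) (SphereLocalIsometry.sphereExp E3 2 o) (Lg o (basePt o))
        (fderiv ℝ (LgE o) (basePt o : E3) ζ)) : E3) = fderiv ℝ nE (basePt o : E3) ζ := by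
    rw [← hdΦ, h123, h23, mfderiv_Lg hy]
    rfl
  rw [Lg_basePt, sphere_mfderiv_zero_apply', SphereLocalIsometry.sphereExp_zero] at hvec
  rw [hvec, fderiv_nE_apply (coe_ne_zero _), coe_basePt, norm_eq_of_mem_sphere]
  simp

/-- `g_round(d(LgE o)_õ ζ, ε) = ⟨ζ, dι ε⟩` at the base point. [folklore] -/
theorem roundMetric_fderiv_LgE_basePt (o : sphere (0 : E3) 1) (ζ : E3) (ε : TangentSpace (𝓡 2) o) :
    (gS).val o (fderiv ℝ (LgE o) (basePt o : E3) ζ) ε = ⟪ζ, dι[o] ε⟫ₑ := by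
  rw [roundMetric_apply_E3, mfderiv_coe_fderiv_LgE_basePt, inner_add_left, real_inner_smul_left,
    inner_coe_mfderiv_coe_sphere, mul_zero, add_zero]

end Model

/-! ### The developing map at its base point -/

variable {M : Type*} [TopologicalSpace M] [ChartedSpace (EuclideanSpace ℝ (Fin 3)) M]
  [IsManifold (𝓡 3) ∞ M]
  (g : PseudoRiemannianMetric (𝓡 3) ∞ (EuclideanSpace ℝ (Fin 3)) (TangentSpace (𝓡 3) : M → Type _))
  [g.HasLeviCivita]

namespace DegenerateShrinker

section Along

variable [T2Space M] [ConnectedSpace M]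
  (hg : ∀ (x : M) (v : TangentSpace (𝓡 3) x), v ≠ 0 → 0 < g.val x v v)
  {f : M → ℝ} (hf : ContMDiff (𝓡 3) 𝓘(ℝ, ℝ) ∞ f) {lam : ℝ}
  (hsol : ∀ (x : M) (X Y : TangentSpace (𝓡 3) x),
    g.ricci x X Y + g.hessian f x X Y = lam * g.val x X Y)
  (hRic0 : ∀ (x : M) (w : TangentSpace (𝓡 3) x), 0 ≤ g.ricci x w w)
  (hS : ∀ x, 0 < g.scalarCurvature x) {p₀ : M} {w₀ : TangentSpace (𝓡 3) p₀} (hw₀ : w₀ ≠ 0)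
  (hnull : g.ricci p₀ w₀ w₀ = 0)
  {κ : (x : M) → TangentSpace (𝓡 3) x → ℝ}
  (hκ : ∀ (x : M) (w : TangentSpace (𝓡 3) x),
    κ x w = g.val x w w - 2 / g.scalarCurvature x * g.ricci x w w)

omit [IsManifold (𝓡 3) ∞ M] [g.HasLeviCivita] [T2Space M] [ConnectedSpace M] in
/-- `VE` vanishes at the base point. [folklore] -/
theorem VE_basePt {o : sphere (0 : E3) 1} (ε₀ ε₁ : TangentSpace (𝓡 2) o) (x : M)
    (a₁ a₂ ν : TangentSpace (𝓡 3) x) : VE o ε₀ ε₁ x a₁ a₂ ν (basePt o) = 0 := by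
  have h1 : LgE o (basePt o : E3) = 0 := by rw [← Lg_eq_LgE, Lg_basePt]
  have h2 : LE (basePt o : E3) = 0 := by
    rw [LE_eq_log (coe_ne_zero _), coe_basePt]; simp
  have h1' : (gS).val o (LgE o (basePt o : E3)) = 0 := by rw [h1]; exact map_zero _
  rw [VE, h1', h2]
  simp only [_root_.zero_apply, mul_zero, zero_smul, add_zero]

omit [ConnectedSpace M] in
/-- **The differential of the developing map at its base point**:
`dF_õ ζ = √2 ⟨ζ, dι ε₀⟩ a₁ + √2 ⟨ζ, dι ε₁⟩ a₂ + √2 ⟨õ, ζ⟩ ν`. [folklore] -/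
theorem mfderiv_devMap_basePt_apply [CovariantDerivative.ContMDiffCovariantDerivative g.leviCivita 1]
    [CovariantDerivative.ContMDiffCovariantDerivative g.leviCivita ∞]
    (hc : IsGeodesicallyComplete g.leviCivita) {o : sphere (0 : E3) 1} (ε₀ ε₁ : TangentSpace (𝓡 2) o)
    (x : M) (a₁ a₂ ν : TangentSpace (𝓡 3) x) (ζ : E3) :
    mfderiv 𝓘(ℝ, E3) (𝓡 3) (devMap g o ε₀ ε₁ x a₁ a₂ ν) (basePt o) ζ =
      (Real.sqrt 2 * ⟪ζ, dι[o] ε₀⟫ₑ) • a₁ + (Real.sqrt 2 * ⟪ζ, dι[o] ε₁⟫ₑ) • a₂ +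
        (Real.sqrt 2 * ⟪(o : E3), ζ⟫ₑ) • ν := by
  rw [mfderiv_devMap_apply g hc (basePt_mem_Uo o), roundMetric_fderiv_LgE_basePt,
    roundMetric_fderiv_LgE_basePt, coe_basePt, norm_eq_of_mem_sphere, one_pow, div_one]
  -- `d(exp_x)_0 = id`
  have h0 := mfderiv_expMap_zero (cov := g.leviCivita) (I := 𝓡 3) x
  suffices H : ∀ (v : EuclideanSpace ℝ (Fin 3)) (hv : v = 0) (w : EuclideanSpace ℝ (Fin 3)),
      @Eq (EuclideanSpace ℝ (Fin 3)) (mfderiv 𝓘(ℝ, EuclideanSpace ℝ (Fin 3)) (𝓡 3)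
        (fun w : EuclideanSpace ℝ (Fin 3) ↦ expMap g.leviCivita x (show TangentSpace (𝓡 3) x from w))
        v w) w by
    exact H _ (VE_basePt ε₀ ε₁ x a₁ a₂ ν) _
  intro v hv w
  subst hv
  rw [h0]
  rfl

set_option maxHeartbeats 1600000 in
include hg hf hsol hRic0 hS hw₀ hnull hκ in
/-- **`dF_y(y)` is `√2` times a unit null vector**, for `y` off the antipodal ray.
[cite: MunteanuWang2016, Thm. 1.2] -/
theorem val_ricci_mfderiv_devMap_radial (hS1 : ∀ x, g.scalarCurvature x = 1)
    (hc : IsGeodesicallyComplete g.leviCivita) {o : sphere (0 : E3) 1} {ε₀ ε₁ : TangentSpace (𝓡 2) o}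
    {x : M} {a₁ a₂ ν : TangentSpace (𝓡 3) x}
    (h11 : g.val x a₁ a₁ = 1) (h22 : g.val x a₂ a₂ = 1) (hνν : g.val x ν ν = 1)
    (h12 : g.val x a₁ a₂ = 0) (h1ν : g.val x a₁ ν = 0) (h2ν : g.val x a₂ ν = 0)
    (hν : g.ricci x ν ν = 0) {y : P3} (hy : y ∈ Uo o) :
    g.val (devMap g o ε₀ ε₁ x a₁ a₂ ν y)
      (mfderiv 𝓘(ℝ, E3) (𝓡 3) (devMap g o ε₀ ε₁ x a₁ a₂ ν) y (y : E3))
      (mfderiv 𝓘(ℝ, E3) (𝓡 3) (devMap g o ε₀ ε₁ x a₁ a₂ ν) y (y : E3)) = 2 ∧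
    g.ricci (devMap g o ε₀ ε₁ x a₁ a₂ ν y)
      (mfderiv 𝓘(ℝ, E3) (𝓡 3) (devMap g o ε₀ ε₁ x a₁ a₂ ν) y (y : E3))
      (mfderiv 𝓘(ℝ, E3) (𝓡 3) (devMap g o ε₀ ε₁ x a₁ a₂ ν) y (y : E3)) = 0 := by
  haveI := contMDiffCovariantDerivative_leviCivita_one g
  haveI := contMDiffCovariantDerivative_leviCivita_infty g le_rfl
  have h2 : Real.sqrt 2 ^ 2 = 2 := Real.sq_sqrt (by norm_num)
  rw [mfderiv_devMap_radial g hc hy, devMap_apply]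
  -- write `VE y = ρ u + s ν` with `u` a unit leaf vector
  set l0 := (gS).val o (LgE o y) ε₀ with hl0
  set l1 := (gS).val o (LgE o y) ε₁ with hl1
  set τ := LE (y : E3) with hτ
  have hVE : VE o ε₀ ε₁ x a₁ a₂ ν y =
      (Real.sqrt 2 * l0) • a₁ + (Real.sqrt 2 * l1) • a₂ + (Real.sqrt 2 * τ) • ν := rfl
  -- the unit-null statement for `d(exp)(ν)` at `v = w₁ a₁ + w₂ a₂ + σ ν`
  have key : ∀ w₁ w₂ σ : ℝ,
      g.val (expMap g.leviCivita x (w₁ • a₁ + w₂ • a₂ + σ • ν))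
        (mfderiv 𝓘(ℝ, EuclideanSpace ℝ (Fin 3)) (𝓡 3)
          (fun w : EuclideanSpace ℝ (Fin 3) ↦ expMap g.leviCivita x (show TangentSpace (𝓡 3) x from w))
          (show EuclideanSpace ℝ (Fin 3) from w₁ • a₁ + w₂ • a₂ + σ • ν) ν)
        (mfderiv 𝓘(ℝ, EuclideanSpace ℝ (Fin 3)) (𝓡 3)
          (fun w : EuclideanSpace ℝ (Fin 3) ↦ expMap g.leviCivita x (show TangentSpace (𝓡 3) x from w))
          (show EuclideanSpace ℝ (Fin 3) from w₁ • a₁ + w₂ • a₂ + σ • ν) ν) = 1 ∧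
      g.ricci (expMap g.leviCivita x (w₁ • a₁ + w₂ • a₂ + σ • ν))
        (mfderiv 𝓘(ℝ, EuclideanSpace ℝ (Fin 3)) (𝓡 3)
          (fun w : EuclideanSpace ℝ (Fin 3) ↦ expMap g.leviCivita x (show TangentSpace (𝓡 3) x from w))
          (show EuclideanSpace ℝ (Fin 3) from w₁ • a₁ + w₂ • a₂ + σ • ν) ν)
        (mfderiv 𝓘(ℝ, EuclideanSpace ℝ (Fin 3)) (𝓡 3)
          (fun w : EuclideanSpace ℝ (Fin 3) ↦ expMap g.leviCivita x (show TangentSpace (𝓡 3) x from w))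
          (show EuclideanSpace ℝ (Fin 3) from w₁ • a₁ + w₂ • a₂ + σ • ν) ν) = 0 := by
    intro w₁ w₂ σ
    by_cases hL : w₁ ^ 2 + w₂ ^ 2 = 0
    · have hw1 : w₁ = 0 := by nlinarith [sq_nonneg w₁, sq_nonneg w₂]
      have hw2 : w₂ = 0 := by nlinarith [sq_nonneg w₁, sq_nonneg w₂]
      have hv : w₁ • a₁ + w₂ • a₂ + σ • ν = (0 : ℝ) • a₁ + σ • ν := by
        rw [hw1, hw2, zero_smul, zero_smul, zero_add, zero_add]
      rw [hv]
      have hj : ∀ t : ℝ, HasDerivAt (fun t : ℝ ↦ t) ((fun _ ↦ (1 : ℝ)) t) t := fun t ↦ hasDerivAt_id' t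
      have hj₁ : ∀ t : ℝ, HasDerivAt (fun _ : ℝ ↦ (1 : ℝ)) (-((0 : ℝ) ^ 2 / 2) * t) t := fun t ↦
        (hasDerivAt_const t (1 : ℝ)).congr_deriv (by ring)
      exact val_ricci_mfderiv_expMap_nu g hg hf hsol hRic0 hS hw₀ hnull hκ hS1 hc h11 h22 hνν h12 h1ν h2ν
        hν 0 σ hj hj₁ rfl rfl
    · set r : ℝ := Real.sqrt (w₁ ^ 2 + w₂ ^ 2) with hr
      have hL0 : 0 < w₁ ^ 2 + w₂ ^ 2 := lt_of_le_of_ne (by positivity) (Ne.symm hL)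
      have hr0 : 0 < r := Real.sqrt_pos.2 hL0
      have hr2 : r ^ 2 = w₁ ^ 2 + w₂ ^ 2 := Real.sq_sqrt hL0.le
      have hαβ : (w₁ / r) ^ 2 + (w₂ / r) ^ 2 = 1 := by
        field_simp; rw [hr2]
      obtain ⟨huu, hnn, hun, huν, hnν⟩ := frame_rotation g h11 h22 h12 h1ν h2ν hαβ
      have hs2 : 0 < Real.sqrt 2 := Real.sqrt_pos.2 (by norm_num)
      have h22' : Real.sqrt 2 ^ 2 = 2 := Real.sq_sqrt (by norm_num)
      have hj : ∀ t, HasDerivAt (fun t ↦ Real.sqrt 2 / r * Real.sin (r * t / Real.sqrt 2))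
          (Real.cos (r * t / Real.sqrt 2)) t := by
        intro t
        have h := ((Real.hasDerivAt_sin _).comp t
          (((hasDerivAt_id' t).const_mul r).div_const (Real.sqrt 2))).const_mul (Real.sqrt 2 / r)
        refine h.congr_deriv ?_
        field_simp
      have hj₁ : ∀ t, HasDerivAt (fun t ↦ Real.cos (r * t / Real.sqrt 2))
          (-(r ^ 2 / 2) * (Real.sqrt 2 / r * Real.sin (r * t / Real.sqrt 2))) t := by
        intro t
        have h := (Real.hasDerivAt_cos _).comp t
          (((hasDerivAt_id' t).const_mul r).div_const (Real.sqrt 2))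
        refine h.congr_deriv ?_
        field_simp
        rw [h22']
        ring
      have h := val_ricci_mfderiv_expMap_nu g hg hf hsol hRic0 hS hw₀ hnull hκ hS1 hc huu hnn hνν hun huν
        hnν hν r σ hj hj₁ (by simp) (by simp)
      have hv : r • ((w₁ / r) • a₁ + (w₂ / r) • a₂) + σ • ν = w₁ • a₁ + w₂ • a₂ + σ • ν := by
        rw [smul_add, smul_smul, smul_smul, mul_div_cancel₀ _ hr0.ne', mul_div_cancel₀ _ hr0.ne']
      rw [hv] at h
      exact h
  obtain ⟨k1, k2⟩ := key (Real.sqrt 2 * l0) (Real.sqrt 2 * l1) (Real.sqrt 2 * τ)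
  rw [← hVE] at k1 k2
  -- read the differential as a plain map `T_xM → T_qM` (consistent instances for rewriting)
  set q : M := expMap g.leviCivita x (VE o ε₀ ε₁ x a₁ a₂ ν y) with hq
  set Ef : TangentSpace (𝓡 3) x → TangentSpace (𝓡 3) q := fun w ↦
    mfderiv 𝓘(ℝ, EuclideanSpace ℝ (Fin 3)) (𝓡 3)
      (fun w : EuclideanSpace ℝ (Fin 3) ↦ expMap g.leviCivita x (show TangentSpace (𝓡 3) x from w))
      (show EuclideanSpace ℝ (Fin 3) from VE o ε₀ ε₁ x a₁ a₂ ν y) w with hEf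
  have hlin : Ef (Real.sqrt 2 • ν) = Real.sqrt 2 • Ef ν := ContinuousLinearMap.map_smul _ _ _
  have k1' : g.val q (Ef ν) (Ef ν) = 1 := k1
  have k2' : g.ricci q (Ef ν) (Ef ν) = 0 := k2
  change g.val q (Ef (Real.sqrt 2 • ν)) (Ef (Real.sqrt 2 • ν)) = 2 ∧
    g.ricci q (Ef (Real.sqrt 2 • ν)) (Ef (Real.sqrt 2 • ν)) = 0
  rw [hlin]
  refine ⟨?_, ?_⟩
  · have e : g.val q (Real.sqrt 2 • Ef ν) (Real.sqrt 2 • Ef ν) =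
        Real.sqrt 2 * Real.sqrt 2 * g.val q (Ef ν) (Ef ν) := by
      simp only [map_smul, smul_apply, smul_eq_mul]; ring
    rw [e, k1', mul_one, ← sq, h2]
  · have e : g.ricci q (Real.sqrt 2 • Ef ν) (Real.sqrt 2 • Ef ν) =
        Real.sqrt 2 * Real.sqrt 2 * g.ricci q (Ef ν) (Ef ν) := by
      simp only [map_smul, LinearMap.smul_apply, smul_eq_mul]; ring
    rw [e, k2', mul_zero]

/-! ### The second chart -/

/-- The data of a developing map: a base point `õ ∈ S²` with a `g_round`-orthonormal pair, and a
point of `M` with an orthonormal frame whose last vector is `Ric`-null. [folklore] -/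
structure DevData (M : Type*) [TopologicalSpace M] [ChartedSpace (EuclideanSpace ℝ (Fin 3)) M] where
  /-- base point on the unit sphere -/
  o : sphere (0 : E3) 1
  /-- first tangent vector at `o` -/
  ε₀ : TangentSpace (𝓡 2) o
  /-- second tangent vector at `o` -/
  ε₁ : TangentSpace (𝓡 2) o
  /-- base point in `M` -/
  x : M
  /-- first leaf vector -/
  a₁ : TangentSpace (𝓡 3) x
  /-- second leaf vector -/
  a₂ : TangentSpace (𝓡 3) x
  /-- null vector -/
  ν : TangentSpace (𝓡 3) x

variable {g}

/-- The hypotheses on developing data. [folklore] -/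
structure DevData.Good (D : DevData M) : Prop where
  e00 : (gS).val D.o D.ε₀ D.ε₀ = 1
  e11 : (gS).val D.o D.ε₁ D.ε₁ = 1
  e01 : (gS).val D.o D.ε₀ D.ε₁ = 0
  h11 : g.val D.x D.a₁ D.a₁ = 1
  h22 : g.val D.x D.a₂ D.a₂ = 1
  hνν : g.val D.x D.ν D.ν = 1
  h12 : g.val D.x D.a₁ D.a₂ = 0
  h1ν : g.val D.x D.a₁ D.ν = 0
  h2ν : g.val D.x D.a₂ D.ν = 0
  hν : g.ricci D.x D.ν D.ν = 0

variable (g)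

/-- The developing map of a datum. [folklore] -/
def DevData.map (D : DevData M) : P3 → M := devMap g D.o D.ε₀ D.ε₁ D.x D.a₁ D.a₂ D.ν

omit [T2Space M] [ConnectedSpace M] in
/-- Unfolding `DevData.map`. [folklore] -/
theorem DevData.map_def (D : DevData M) : D.map g = devMap g D.o D.ε₀ D.ε₁ D.x D.a₁ D.a₂ D.ν := rfl

set_option maxHeartbeats 800000 in
include hg hf hsol hRic0 hS hw₀ hnull hκ in
/-- The frame of the second chart is orthonormal: `g(dF u/√2, dF w/√2) = ⟨u, w⟩` at `õ'` (`dF` is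
isometric and `g_c = 2δ` at `|õ'| = 1`). [cite: doCarmo1992, Ch. 8, Thm. 4.1] -/
theorem DevData.second_frame (hS1 : ∀ x, g.scalarCurvature x = 1)
    (hc : IsGeodesicallyComplete g.leviCivita) {D : DevData M} (hD : D.Good (g := g))
    {o' : sphere (0 : E3) 1} (ho' : ⟪(o' : E3), (D.o : E3)⟫ₑ = 0) (u w : E3) :
    g.val (D.map g (basePt o'))
      ((Real.sqrt 2)⁻¹ • mfderiv 𝓘(ℝ, E3) (𝓡 3) (D.map g) (basePt o') u)
      ((Real.sqrt 2)⁻¹ • mfderiv 𝓘(ℝ, E3) (𝓡 3) (D.map g) (basePt o') w) = ⟪u, w⟫ₑ := by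
  haveI := contMDiffCovariantDerivative_leviCivita_one g
  haveI := contMDiffCovariantDerivative_leviCivita_infty g le_rfl
  have hy : basePt o' ∈ Uo D.o := basePt_mem_Uo_of_inner_eq_zero ho'
  have h := val_mfderiv_devMap g hg hf hsol hRic0 hS hw₀ hnull hκ hS1 hc hD.h11 hD.h22 hD.hνν
    hD.h12 hD.h1ν hD.h2ν hD.hν hD.e00 hD.e11 hD.e01 hy u w
  have h2 : Real.sqrt 2 ^ 2 = 2 := Real.sq_sqrt (by norm_num)
  have hn1 : ‖((basePt o' : P3) : E3)‖ = 1 := by rw [coe_basePt]; exact norm_eq_of_mem_sphere o'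
  rw [cyl3_apply, hn1, one_pow, div_one] at h
  set q : M := D.map g (basePt o') with hq
  set Lf : E3 → TangentSpace (𝓡 3) q := fun u ↦ mfderiv 𝓘(ℝ, E3) (𝓡 3) (D.map g) (basePt o') u
    with hLf
  have h' : g.val q (Lf u) (Lf w) = 2 * ⟪u, w⟫ₑ := h
  change g.val q ((Real.sqrt 2)⁻¹ • Lf u) ((Real.sqrt 2)⁻¹ • Lf w) = _
  have e : g.val q ((Real.sqrt 2)⁻¹ • Lf u) ((Real.sqrt 2)⁻¹ • Lf w) =
      ((Real.sqrt 2)⁻¹) ^ 2 * g.val q (Lf u) (Lf w) := by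
    simp only [map_smul, smul_apply, smul_eq_mul]; ring
  rw [e, h', inv_pow, h2]
  ring

set_option maxHeartbeats 800000 in
include hg hf hsol hRic0 hS hw₀ hnull hκ in
/-- The last vector of the second frame is `Ric`-null (`val_ricci_mfderiv_devMap_radial`).
[cite: MunteanuWang2016, Thm. 1.2] -/
theorem DevData.second_null (hS1 : ∀ x, g.scalarCurvature x = 1)
    (hc : IsGeodesicallyComplete g.leviCivita) {D : DevData M} (hD : D.Good (g := g))
    {o' : sphere (0 : E3) 1} (ho' : ⟪(o' : E3), (D.o : E3)⟫ₑ = 0) :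
    g.ricci (D.map g (basePt o'))
      ((Real.sqrt 2)⁻¹ • mfderiv 𝓘(ℝ, E3) (𝓡 3) (D.map g) (basePt o') (o' : E3))
      ((Real.sqrt 2)⁻¹ • mfderiv 𝓘(ℝ, E3) (𝓡 3) (D.map g) (basePt o') (o' : E3)) = 0 := by
  haveI := contMDiffCovariantDerivative_leviCivita_one g
  haveI := contMDiffCovariantDerivative_leviCivita_infty g le_rfl
  have hy : basePt o' ∈ Uo D.o := basePt_mem_Uo_of_inner_eq_zero ho'
  have hrad := val_ricci_mfderiv_devMap_radial g hg hf hsol hRic0 hS hw₀ hnull hκ hS1 hc (ε₀ := D.ε₀)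
    (ε₁ := D.ε₁) hD.h11 hD.h22 hD.hνν hD.h12 hD.h1ν hD.h2ν hD.hν hy
  set q : M := D.map g (basePt o') with hq
  set Lf : E3 → TangentSpace (𝓡 3) q := fun u ↦ mfderiv 𝓘(ℝ, E3) (𝓡 3) (D.map g) (basePt o') u
    with hLf
  have h0 : g.ricci q (Lf (o' : E3)) (Lf (o' : E3)) = 0 := hrad.2
  change g.ricci q ((Real.sqrt 2)⁻¹ • Lf (o' : E3)) ((Real.sqrt 2)⁻¹ • Lf (o' : E3)) = 0
  have e : g.ricci q ((Real.sqrt 2)⁻¹ • Lf (o' : E3)) ((Real.sqrt 2)⁻¹ • Lf (o' : E3)) =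
      ((Real.sqrt 2)⁻¹) ^ 2 * g.ricci q (Lf (o' : E3)) (Lf (o' : E3)) := by
    simp only [map_smul, LinearMap.smul_apply, smul_eq_mul]; ring
  rw [e, h0, mul_zero]

omit [ConnectedSpace M] in
/-- **The 1-jet of a developing map built from a linear map `L : ℝ³ → T_xM`**: if the frame is
`(L(dι ε₀')/√2, L(dι ε₁')/√2, L(õ')/√2)` with `(dι ε₀', dι ε₁', õ')` orthonormal in `ℝ³`, then
`dF_{õ'} = L`. [cite: doCarmo1992, Ch. 8, Thm. 4.1] -/
theorem mfderiv_devMap_basePt_eq_of_frame [CovariantDerivative.ContMDiffCovariantDerivative g.leviCivita 1]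
    [CovariantDerivative.ContMDiffCovariantDerivative g.leviCivita ∞]
    (hc : IsGeodesicallyComplete g.leviCivita) {o' : sphere (0 : E3) 1}
    {ε₀' ε₁' : TangentSpace (𝓡 2) o'}
    (e00 : (gS).val o' ε₀' ε₀' = 1) (e11 : (gS).val o' ε₁' ε₁' = 1) (e01 : (gS).val o' ε₀' ε₁' = 0)
    {x : M} (L : E3 →L[ℝ] EuclideanSpace ℝ (Fin 3)) :
    @Eq (E3 →L[ℝ] EuclideanSpace ℝ (Fin 3))
      (mfderiv 𝓘(ℝ, E3) (𝓡 3) (devMap g o' ε₀' ε₁' x ((Real.sqrt 2)⁻¹ • L (dι[o'] ε₀'))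
        ((Real.sqrt 2)⁻¹ • L (dι[o'] ε₁')) ((Real.sqrt 2)⁻¹ • L (o' : E3))) (basePt o')) L := by
  -- (the equation is typed in the model space `ℝ³ →L ℝ³`: kernel-friendly across base points)
  apply ContinuousLinearMap.ext
  intro ζ
  refine (mfderiv_devMap_basePt_apply g hc ε₀' ε₁' _ _ _ _ ζ).trans ?_
  have hs2 : Real.sqrt 2 ≠ 0 := (Real.sqrt_pos.2 (by norm_num)).ne'
  -- expand `ζ` in the orthonormal triple `(dι ε₀', dι ε₁', o')`
  have i00 : ⟪dι[o'] ε₀', dι[o'] ε₀'⟫ₑ = 1 := by rw [← roundMetric_apply_E3]; exact e00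
  have i11 : ⟪dι[o'] ε₁', dι[o'] ε₁'⟫ₑ = 1 := by rw [← roundMetric_apply_E3]; exact e11
  have i01 : ⟪dι[o'] ε₀', dι[o'] ε₁'⟫ₑ = 0 := by rw [← roundMetric_apply_E3]; exact e01
  have i0o : ⟪dι[o'] ε₀', (o' : E3)⟫ₑ = 0 := by
    rw [real_inner_comm]; exact inner_coe_mfderiv_coe_sphere o' ε₀'
  have i1o : ⟪dι[o'] ε₁', (o' : E3)⟫ₑ = 0 := by
    rw [real_inner_comm]; exact inner_coe_mfderiv_coe_sphere o' ε₁'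
  have ioo : ⟪(o' : E3), (o' : E3)⟫ₑ = 1 := by
    rw [real_inner_self_eq_norm_sq, norm_eq_of_mem_sphere, one_pow]
  have hζ := eq_sum_inner_of_orthonormal_three i00 i11 ioo i01 i0o i1o ζ
  set Lf : E3 → TangentSpace (𝓡 3) x := fun u ↦ L u with hLf
  set A : E3 := dι[o'] ε₀' with hA
  set B : E3 := dι[o'] ε₁' with hB
  have hadd : ∀ u w : E3, Lf (u + w) = Lf u + Lf w := fun u w ↦ L.map_add u w
  have hsmul : ∀ (c : ℝ) (u : E3), Lf (c • u) = c • Lf u := fun c u ↦ L.map_smul c u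
  change (Real.sqrt 2 * ⟪ζ, A⟫ₑ) • (Real.sqrt 2)⁻¹ • Lf A + (Real.sqrt 2 * ⟪ζ, B⟫ₑ) • (Real.sqrt 2)⁻¹ • Lf B +
    (Real.sqrt 2 * ⟪(o' : E3), ζ⟫ₑ) • (Real.sqrt 2)⁻¹ • Lf (o' : E3) = Lf ζ
  have hLζ : Lf ζ = ⟪ζ, A⟫ₑ • Lf A + ⟪ζ, B⟫ₑ • Lf B + ⟪ζ, (o' : E3)⟫ₑ • Lf (o' : E3) := by
    conv_lhs => rw [hζ]
    rw [hadd, hadd, hsmul, hsmul, hsmul]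
  have hcoef : ∀ a : ℝ, Real.sqrt 2 * a * (Real.sqrt 2)⁻¹ = a := fun a ↦ by field_simp
  have hio : ⟪(o' : E3), ζ⟫ₑ = ⟪ζ, (o' : E3)⟫ₑ := real_inner_comm _ _
  rw [hLζ, smul_smul, smul_smul, smul_smul, hcoef, hcoef, hcoef, hio]

include hg hf hsol hRic0 hS hw₀ hnull hκ in
/-- **The second chart**: at `õ' ⊥ õ` with a `g_round`-orthonormal pair `(ε₀', ε₁')` there is a good
developing datum `(õ', ε₀', ε₁', x', a₁', a₂', ν')` whose developing map has the same 1-jet at `õ'`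
as `F = D.map` — namely `x' = F(õ')`, `aᵢ' = dF(dι εᵢ')/√2`, `ν' = dF(õ')/√2` (do Carmo's
continuation step). [cite: doCarmo1992, Ch. 8, Thm. 4.1] [cite: MunteanuWang2016, Thm. 1.2] -/
theorem DevData.exists_second (hS1 : ∀ x, g.scalarCurvature x = 1)
    (hc : IsGeodesicallyComplete g.leviCivita) {D : DevData M} (hD : D.Good (g := g))
    {o' : sphere (0 : E3) 1} (ho' : ⟪(o' : E3), (D.o : E3)⟫ₑ = 0) {ε₀' ε₁' : TangentSpace (𝓡 2) o'}
    (e00 : (gS).val o' ε₀' ε₀' = 1) (e11 : (gS).val o' ε₁' ε₁' = 1) (e01 : (gS).val o' ε₀' ε₁' = 0) :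
    ∃ (x : M) (a₁ a₂ ν : TangentSpace (𝓡 3) x),
      (DevData.mk o' ε₀' ε₁' x a₁ a₂ ν).Good (g := g) ∧
      devMap g o' ε₀' ε₁' x a₁ a₂ ν (basePt o') = D.map g (basePt o') ∧
      @Eq (E3 →L[ℝ] EuclideanSpace ℝ (Fin 3))
        (mfderiv 𝓘(ℝ, E3) (𝓡 3) (devMap g o' ε₀' ε₁' x a₁ a₂ ν) (basePt o'))
        (mfderiv 𝓘(ℝ, E3) (𝓡 3) (D.map g) (basePt o')) := by
  haveI := contMDiffCovariantDerivative_leviCivita_one g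
  haveI := contMDiffCovariantDerivative_leviCivita_infty g le_rfl
  have hF := DevData.second_frame g hg hf hsol hRic0 hS hw₀ hnull hκ hS1 hc hD ho'
  have i00 : ⟪dι[o'] ε₀', dι[o'] ε₀'⟫ₑ = 1 := by rw [← roundMetric_apply_E3]; exact e00
  have i11 : ⟪dι[o'] ε₁', dι[o'] ε₁'⟫ₑ = 1 := by rw [← roundMetric_apply_E3]; exact e11
  have i01 : ⟪dι[o'] ε₀', dι[o'] ε₁'⟫ₑ = 0 := by rw [← roundMetric_apply_E3]; exact e01
  have i0o : ⟪dι[o'] ε₀', (o' : E3)⟫ₑ = 0 := by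
    rw [real_inner_comm]; exact inner_coe_mfderiv_coe_sphere o' ε₀'
  have i1o : ⟪dι[o'] ε₁', (o' : E3)⟫ₑ = 0 := by
    rw [real_inner_comm]; exact inner_coe_mfderiv_coe_sphere o' ε₁'
  have ioo : ⟪(o' : E3), (o' : E3)⟫ₑ = 1 := by
    rw [real_inner_self_eq_norm_sq, norm_eq_of_mem_sphere, one_pow]
  refine ⟨D.map g (basePt o'),
    (Real.sqrt 2)⁻¹ • mfderiv 𝓘(ℝ, E3) (𝓡 3) (D.map g) (basePt o') (dι[o'] ε₀'),
    (Real.sqrt 2)⁻¹ • mfderiv 𝓘(ℝ, E3) (𝓡 3) (D.map g) (basePt o') (dι[o'] ε₁'),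
    (Real.sqrt 2)⁻¹ • mfderiv 𝓘(ℝ, E3) (𝓡 3) (D.map g) (basePt o') (o' : E3),
    ⟨e00, e11, e01, (hF _ _).trans i00, (hF _ _).trans i11, (hF _ _).trans ioo,
      (hF _ _).trans i01, (hF _ _).trans i0o, (hF _ _).trans i1o,
      DevData.second_null g hg hf hsol hRic0 hS hw₀ hnull hκ hS1 hc hD ho'⟩,
    devMap_basePt g, mfderiv_devMap_basePt_eq_of_frame g hc e00 e11 e01 (x := D.map g (basePt o'))
      (mfderiv 𝓘(ℝ, E3) (𝓡 3) (D.map g) (basePt o'))⟩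

/-! ### Rigidity on the overlap and gluing -/

include hg hf hsol hRic0 hS hw₀ hnull hκ in
/-- **Two developing maps with the same 1-jet at `õ'` agree on the overlap** `Uo õ' ∩ Uo õ`
(rigidity of local isometries with equal 1-jets on a preconnected open set).
[cite: ONeill1983, Ch. 3, Prop. 3.62] [cite: doCarmo1992, Ch. 8, Thm. 4.1] -/
theorem DevData.eqOn_of_oneJet (hS1 : ∀ x, g.scalarCurvature x = 1)
    (hc : IsGeodesicallyComplete g.leviCivita) {D D' : DevData M} (hD : D.Good (g := g))
    (hD' : D'.Good (g := g)) (ho' : ⟪(D'.o : E3), (D.o : E3)⟫ₑ = 0)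
    (h0 : D'.map g (basePt D'.o) = D.map g (basePt D'.o))
    (h1 : @Eq (E3 →L[ℝ] EuclideanSpace ℝ (Fin 3)) (mfderiv 𝓘(ℝ, E3) (𝓡 3) (D'.map g) (basePt D'.o))
      (mfderiv 𝓘(ℝ, E3) (𝓡 3) (D.map g) (basePt D'.o))) :
    EqOn (D'.map g) (D.map g) (Uo D'.o ∩ Uo D.o) := by
  haveI := contMDiffCovariantDerivative_leviCivita_one g
  haveI := contMDiffCovariantDerivative_leviCivita_infty g le_rfl
  have hdim : finrank ℝ E3 = finrank ℝ (EuclideanSpace ℝ (Fin 3)) := rfl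
  refine IsometryRigidity.eqOn_of_isometry_of_oneJet_eq (I := 𝓡 3) (I' := 𝓘(ℝ, E3)) (g := g)
    (gN := cyl3) (f₁ := D'.map g) (f₂ := D.map g) hdim ((isOpen_Uo D'.o).inter (isOpen_Uo D.o))
    (isPreconnected_Uo_inter D'.o D.o)
    (fun y hy ↦ (contMDiffAt_devMap g hc hy.1).contMDiffWithinAt)
    (fun y hy ↦ (contMDiffAt_devMap g hc hy.2).contMDiffWithinAt)
    (fun y hy u w ↦ val_mfderiv_devMap g hg hf hsol hRic0 hS hw₀ hnull hκ hS1 hc hD'.h11 hD'.h22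
      hD'.hνν hD'.h12 hD'.h1ν hD'.h2ν hD'.hν hD'.e00 hD'.e11 hD'.e01 hy.1 u w)
    (fun y hy u w ↦ val_mfderiv_devMap g hg hf hsol hRic0 hS hw₀ hnull hκ hS1 hc hD.h11 hD.h22
      hD.hνν hD.h12 hD.h1ν hD.h2ν hD.hν hD.e00 hD.e11 hD.e01 hy.2 u w)
    ⟨basePt_mem_Uo D'.o, basePt_mem_Uo_of_inner_eq_zero ho'⟩ h0 h1

open Classical in
/-- **The glued developing map**: `F₁ = D.map` off the antipodal ray of `õ`, `F₂ = D'.map` on it.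
[folklore] -/
def DevData.glue (D D' : DevData M) : P3 → M :=
  fun y ↦ if y ∈ Uo D.o then D.map g y else D'.map g y

omit [IsManifold (𝓡 3) ∞ M] [g.HasLeviCivita] [T2Space M] [ConnectedSpace M] in
/-- Every point of `C` lies in `Uo õ` or in `Uo õ'` when `õ' ⊥ õ`. [folklore] -/
theorem mem_Uo_or_mem_Uo {o o' : sphere (0 : E3) 1} (ho' : ⟪(o' : E3), (o : E3)⟫ₑ = 0) (y : P3) :
    y ∈ Uo o ∨ y ∈ Uo o' := by
  by_contra h
  push Not at h
  obtain ⟨h1, h2⟩ := h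
  have e1 : (hat y : E3) = -(o : E3) := by simpa [Uo] using h1
  have e2 : (hat y : E3) = -(o' : E3) := by simpa [Uo] using h2
  have : (o : E3) = (o' : E3) := neg_injective (e1.symm.trans e2)
  have h1' : ⟪(o' : E3), (o : E3)⟫ₑ = 1 := by
    rw [this, real_inner_self_eq_norm_sq, norm_eq_of_mem_sphere, one_pow]
  rw [ho'] at h1'
  exact zero_ne_one h1'

include hg hf hsol hRic0 hS hw₀ hnull hκ in
/-- The glued map is `F₁` near points of `Uo õ` and `F₂` near points of `Uo õ'`. [folklore] -/
theorem DevData.glue_eventuallyEq (hS1 : ∀ x, g.scalarCurvature x = 1)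
    (hc : IsGeodesicallyComplete g.leviCivita) {D D' : DevData M} (hD : D.Good (g := g))
    (hD' : D'.Good (g := g)) (ho' : ⟪(D'.o : E3), (D.o : E3)⟫ₑ = 0)
    (h0 : D'.map g (basePt D'.o) = D.map g (basePt D'.o))
    (h1 : @Eq (E3 →L[ℝ] EuclideanSpace ℝ (Fin 3)) (mfderiv 𝓘(ℝ, E3) (𝓡 3) (D'.map g) (basePt D'.o))
      (mfderiv 𝓘(ℝ, E3) (𝓡 3) (D.map g) (basePt D'.o))) (y : P3) :
    (y ∈ Uo D.o ∧ D.glue g D' =ᶠ[𝓝 y] D.map g) ∨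
    (y ∈ Uo D'.o ∧ D.glue g D' =ᶠ[𝓝 y] D'.map g) := by
  have heq := DevData.eqOn_of_oneJet g hg hf hsol hRic0 hS hw₀ hnull hκ hS1 hc hD hD' ho' h0 h1
  rcases mem_Uo_or_mem_Uo ho' y with hy | hy
  · refine Or.inl ⟨hy, ?_⟩
    filter_upwards [(isOpen_Uo D.o).mem_nhds hy] with y' hy'
    simp [DevData.glue, hy']
  · refine Or.inr ⟨hy, ?_⟩
    filter_upwards [(isOpen_Uo D'.o).mem_nhds hy] with y' hy'
    by_cases h : y' ∈ Uo D.o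
    · simp only [DevData.glue, h, if_true]
      exact (heq ⟨hy', h⟩).symm
    · simp only [DevData.glue, h, if_false]

/-- `f_C(õ) = 1`. [folklore] -/
theorem fP_basePt (o : sphere (0 : E3) 1) : fP (basePt o) = 1 := by
  rw [fP_eq, fE, LE_eq_log (coe_ne_zero _), coe_basePt, norm_eq_of_mem_sphere, Real.log_one]
  norm_num

include hg hf hsol hRic0 hS hw₀ hnull hκ in
/-- **The glued developing map is a smooth isometric immersion of the whole model cylinder
with `f ∘ Φ = f_C`, `Φ(õ) = x`, and `dΦ_y(y)` of length `√2` and `Ric`-null.**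
[cite: doCarmo1992, Ch. 8, Thm. 4.1] [cite: MunteanuWang2016, Thm. 1.2] -/
theorem DevData.glue_spec (hlam : lam = 1 / 2) (hS1 : ∀ x, g.scalarCurvature x = 1)
    (hc : IsGeodesicallyComplete g.leviCivita)
    (hnorm : ∀ x, g.scalarCurvature x + g.gradSq f x = f x) {D D' : DevData M} (hD : D.Good (g := g))
    (hD' : D'.Good (g := g)) (hfx : f D.x = 1) (ho' : ⟪(D'.o : E3), (D.o : E3)⟫ₑ = 0)
    (h0 : D'.map g (basePt D'.o) = D.map g (basePt D'.o))
    (h1 : @Eq (E3 →L[ℝ] EuclideanSpace ℝ (Fin 3)) (mfderiv 𝓘(ℝ, E3) (𝓡 3) (D'.map g) (basePt D'.o))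
      (mfderiv 𝓘(ℝ, E3) (𝓡 3) (D.map g) (basePt D'.o))) :
    ContMDiff 𝓘(ℝ, E3) (𝓡 3) ∞ (D.glue g D') ∧
    (∀ (y : P3) (u w : TangentSpace 𝓘(ℝ, E3) y),
      g.val (D.glue g D' y) (mfderiv 𝓘(ℝ, E3) (𝓡 3) (D.glue g D') y u)
        (mfderiv 𝓘(ℝ, E3) (𝓡 3) (D.glue g D') y w) = cyl3.val y u w) ∧
    (∀ y : P3, f (D.glue g D' y) = fP y) ∧
    (∀ y : P3, g.val (D.glue g D' y)
        (mfderiv 𝓘(ℝ, E3) (𝓡 3) (D.glue g D') y (y : E3))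
        (mfderiv 𝓘(ℝ, E3) (𝓡 3) (D.glue g D') y (y : E3)) = 2 ∧
      g.ricci (D.glue g D' y)
        (mfderiv 𝓘(ℝ, E3) (𝓡 3) (D.glue g D') y (y : E3))
        (mfderiv 𝓘(ℝ, E3) (𝓡 3) (D.glue g D') y (y : E3)) = 0) ∧
    D.glue g D' (basePt D.o) = D.x := by
  haveI := contMDiffCovariantDerivative_leviCivita_one g
  haveI := contMDiffCovariantDerivative_leviCivita_infty g le_rfl
  have hev := DevData.glue_eventuallyEq g hg hf hsol hRic0 hS hw₀ hnull hκ hS1 hc hD hD' ho' h0 h1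
  -- critical points: `|∇f|² = f - S = 0` at `x` and at `x' = F(õ')`
  have hcrit : ∀ x : M, f x = 1 → mvfderiv (𝓡 3) f x = 0 := by
    intro x hx
    apply mvfderiv_eq_zero_of_gradSq_eq_zero g hg hf
    have := hnorm x
    rw [hS1, hx] at this
    linarith
  have hpot : ∀ y : P3, f (D.map g y) = fP y := fun y ↦
    potential_devMap g hg hf hsol hRic0 hS hw₀ hnull hκ hlam hS1 hc hfx (hcrit _ hfx) hD.hνν hD.h1ν
      hD.h2ν hD.hν y
  have hfx' : f D'.x = 1 := by
    have e : D'.map g (basePt D'.o) = D'.x := devMap_basePt g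
    rw [← e, h0, hpot, fP_basePt]
  have hpot' : ∀ y : P3, f (D'.map g y) = fP y := fun y ↦
    potential_devMap g hg hf hsol hRic0 hS hw₀ hnull hκ hlam hS1 hc hfx' (hcrit _ hfx') hD'.hνν hD'.h1ν
      hD'.h2ν hD'.hν y
  -- pointwise transfer from the local representatives
  have key : ∀ y : P3, ∃ F : P3 → M, D.glue g D' =ᶠ[𝓝 y] F ∧
      ContMDiffAt 𝓘(ℝ, E3) (𝓡 3) ∞ F y ∧
      (∀ u w : TangentSpace 𝓘(ℝ, E3) y, g.val (F y) (mfderiv 𝓘(ℝ, E3) (𝓡 3) F y u)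
        (mfderiv 𝓘(ℝ, E3) (𝓡 3) F y w) = cyl3.val y u w) ∧
      f (F y) = fP y ∧
      (g.val (F y) (mfderiv 𝓘(ℝ, E3) (𝓡 3) F y (y : E3)) (mfderiv 𝓘(ℝ, E3) (𝓡 3) F y (y : E3)) = 2 ∧
        g.ricci (F y) (mfderiv 𝓘(ℝ, E3) (𝓡 3) F y (y : E3))
          (mfderiv 𝓘(ℝ, E3) (𝓡 3) F y (y : E3)) = 0) := by
    intro y
    rcases hev y with ⟨hy, he⟩ | ⟨hy, he⟩
    · exact ⟨_, he, contMDiffAt_devMap g hc hy,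
        fun u w ↦ val_mfderiv_devMap g hg hf hsol hRic0 hS hw₀ hnull hκ hS1 hc hD.h11 hD.h22 hD.hνν
          hD.h12 hD.h1ν hD.h2ν hD.hν hD.e00 hD.e11 hD.e01 hy u w,
        hpot y,
        val_ricci_mfderiv_devMap_radial g hg hf hsol hRic0 hS hw₀ hnull hκ hS1 hc hD.h11 hD.h22 hD.hνν
          hD.h12 hD.h1ν hD.h2ν hD.hν hy⟩
    · exact ⟨_, he, contMDiffAt_devMap g hc hy,
        fun u w ↦ val_mfderiv_devMap g hg hf hsol hRic0 hS hw₀ hnull hκ hS1 hc hD'.h11 hD'.h22 hD'.hνν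
          hD'.h12 hD'.h1ν hD'.h2ν hD'.hν hD'.e00 hD'.e11 hD'.e01 hy u w,
        hpot' y,
        val_ricci_mfderiv_devMap_radial g hg hf hsol hRic0 hS hw₀ hnull hκ hS1 hc hD'.h11 hD'.h22
          hD'.hνν hD'.h12 hD'.h1ν hD'.h2ν hD'.hν hy⟩
  refine ⟨fun y ↦ ?_, fun y u w ↦ ?_, fun y ↦ ?_, fun y ↦ ?_, ?_⟩
  · obtain ⟨F, he, hF, -, -, -⟩ := key y
    exact hF.congr_of_eventuallyEq he
  · obtain ⟨F, he, -, hiso, -, -⟩ := key y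
    rw [he.mfderiv_eq, he.eq_of_nhds]
    exact hiso u w
  · obtain ⟨F, he, -, -, hpot, -⟩ := key y
    rw [he.eq_of_nhds]
    exact hpot
  · obtain ⟨F, he, -, -, -, hrad⟩ := key y
    rw [he.mfderiv_eq, he.eq_of_nhds]
    exact hrad
  · have h : basePt D.o ∈ Uo D.o := basePt_mem_Uo D.o
    simp only [DevData.glue, h, if_true]
    exact devMap_basePt g

/-! ### Existence of the developing map -/

/-- A fixed base point of `S²`. [folklore] -/
def o₀ : sphere (0 : E3) 1 := ⟨EuclideanSpace.single 0 1, by simp⟩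

include hg hf hsol hRic0 hS hw₀ hnull hκ in
/-- **Existence of an isometric developing map `Φ : C = S²(√2) × ℝ → M`** through a point `p` with
`f(p) = 1`, for a complete connected normalised (`λ = ½`, `S + |∇f|² = f`) degenerate
three-dimensional shrinker with `S ≡ 1`: `Φ` is `C^∞`, `g(dΦ u, dΦ w) = g_c(u, w)`, `f ∘ Φ = f_C`,
`Φ(õ₀) = p`, and `dΦ_y(y)` has `g`-length `√2` and is `Ric`-null.
[cite: MunteanuWang2016, Thm. 1.2] [cite: doCarmo1992, Ch. 8, Thm. 4.1] -/
theorem exists_isometric_developing (hlam : lam = 1 / 2) (hS1 : ∀ x, g.scalarCurvature x = 1)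
    (hc : IsGeodesicallyComplete g.leviCivita)
    (hnorm : ∀ x, g.scalarCurvature x + g.gradSq f x = f x) {p : M} (hfp : f p = 1) :
    ∃ Φ : P3 → M, ContMDiff 𝓘(ℝ, E3) (𝓡 3) ∞ Φ ∧
      (∀ (y : P3) (u w : TangentSpace 𝓘(ℝ, E3) y),
        g.val (Φ y) (mfderiv 𝓘(ℝ, E3) (𝓡 3) Φ y u) (mfderiv 𝓘(ℝ, E3) (𝓡 3) Φ y w) =
          cyl3.val y u w) ∧
      (∀ y : P3, f (Φ y) = fP y) ∧
      (∀ y : P3, g.val (Φ y) (mfderiv 𝓘(ℝ, E3) (𝓡 3) Φ y (y : E3))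
          (mfderiv 𝓘(ℝ, E3) (𝓡 3) Φ y (y : E3)) = 2 ∧
        g.ricci (Φ y) (mfderiv 𝓘(ℝ, E3) (𝓡 3) Φ y (y : E3))
          (mfderiv 𝓘(ℝ, E3) (𝓡 3) Φ y (y : E3)) = 0) ∧
      Φ (basePt o₀) = p := by
  -- frame at `p`
  obtain ⟨ν, hνν, hν0⟩ := exists_unit_null g hg hf hsol hRic0 hS hw₀ hnull p
  have hν : g.ricci p ν ν = 0 := (hν0 ν).1
  obtain ⟨k, fr, hfrnone, hfron, hcard⟩ := exists_orthonormal_frame_with_head g hg p hνν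
  have hk : k = 2 := by
    simp only [Fintype.card_option, Fintype.card_fin, finrank_euclideanSpace_fin] at hcard
    omega
  subst hk
  -- frame at `õ₀`
  obtain ⟨ε₀, ε₁, e00, e11, e01⟩ := exists_roundMetric_orthonormal o₀
  set D : DevData M := ⟨o₀, ε₀, ε₁, p, fr (some 0), fr (some 1), ν⟩ with hDdef
  have hD : D.Good (g := g) := by
    refine ⟨e00, e11, e01, ?_, ?_, ?_, ?_, ?_, ?_, hν⟩
    · simpa using hfron (some 0) (some 0)
    · simpa using hfron (some 1) (some 1)
    · simpa [hfrnone] using hfron none none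
    · simpa using hfron (some 0) (some 1)
    · simpa [hfrnone] using hfron (some 0) none
    · simpa [hfrnone] using hfron (some 1) none
  -- second base point `õ' ⊥ õ₀`
  obtain ⟨o', ho'⟩ := SphereLocalIsometry.exists_inner_eq_zero (n := 2) (by norm_num) o₀
  obtain ⟨ε₀', ε₁', e00', e11', e01'⟩ := exists_roundMetric_orthonormal o'
  obtain ⟨x', a₁', a₂', ν', hD', h0, h1⟩ := DevData.exists_second g hg hf hsol hRic0 hS hw₀ hnull hκ hS1
    hc hD ho' e00' e11' e01'
  obtain ⟨k1, k2, k3, k4, k5⟩ := DevData.glue_spec g hg hf hsol hRic0 hS hw₀ hnull hκ hlam hS1 hc hnorm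
    (D' := ⟨o', ε₀', ε₁', x', a₁', a₂', ν'⟩) hD hD' hfp ho' h0 h1
  exact ⟨_, k1, k2, k3, k4, k5⟩

end Along

end DegenerateShrinker

end Literature.Geometry.Riemannian

end
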